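import Literature.NumberTheory.Automorphic.Liu2021.LemD1AsPrintedIndexedNonVacuityLevelTwist
import HarnessLib

/-!
# [Liu2021, App. D Lemma D.1 (1) ∧ (3)] AS PRINTED, JOINTLY, with TWO μ-labels — for EVERY rank `N ≥ 3` at EVERY finite place:
# the LEVEL CARRIER CHARACTER `Λ = θ_w ∘ det_w` of `U(V)(F_v)` read on a REFLECTION

Reproduction ∕ bookkeeping (Literature, THEOREMS ONLY: no definition, no record, no named fact, no `sorry`; nothing is
asserted about Liu's oscillator representations or about the tree's constructed local Weil carriers).

Sequel of `LemD1AsPrintedIndexedNonVacuityTameCarrier.lean`, whose «What this does NOT give» opens with «`N` even (then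
`Λ(−1 · 1_N) = 1` …); … places above `2`»: there the carrier character `Λ = θ_w ∘ det_w` (`θ_w` TAME, `w ∤ 2`) was separated from the
trivial character at the CENTRAL element `−1 · 1_N`, of determinant `(−1)^N` — which sees nothing for `N` even —, and the tame `θ_w` sees
nothing above `2`.  THIS FILE removes both restrictions:

* the character is the LEVEL character of `LemD1AsPrintedIndexedNonVacuityLevelTwist.lean` (`θ_w` of finite order, open kernel, trivial
  on `1 + 2𝔭_w`, `θ_w(−1) ≠ 1`, at ANY place `w`);
* the separating element is a REFLECTION: §1–§2 show that the unitary group `U(V)(F_v) = S.U` of the place model contains an element `g₀`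
  with `det g₀ = −1` and `g₀² = 1` for EVERY `N` — the image of the reflection `R = 1 − (2/⟨x,x⟩) · x · x†` (`x† = c(x)ᵀ J`) of the GLOBAL
  hermitian space `(Eᴺ, J)` along an anisotropic vector `x` (`⟨x, x⟩ ≠ 0`; such `x` exists since `J ≠ 0` is hermitian: a diagonal entry
  `J_ii ≠ 0`, or `x = e_i + J_ij⁻¹ e_j` with `⟨x,x⟩ = 2`), for which `(Rᶜ)ᵀ J R = J`, `R² = 1`, `det R = 1 − 2 = −1` (matrix determinant
  lemma) — elementary hermitian geometry over the field `E`, pushed to `E_v = Π_{w∣v} E_w` along `E → E_v`.  So `Λ(g₀) = θ_w(−1) = −1 ≠ 1`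
  whatever the parity of `N`.

Setting: the tree's place model of a quadratic `E/F` at a finite place `v` (`F_v`, `E_v = Π_{w∣v} E_w`, `c ⊗ 1`, `c δ = −δ ≠ 0`, the standing data
`S = LemD1OfPlace.standingData …` with `U(V)(F_v) = S.U ≤ GL_N(E_v)`, centre `E_v¹ = S.normOne`, `S.scalar`), ANY place `w ∣ v`, ANY `N ≥ 2`.

* §1 (private algebra over `E`): anisotropic vectors and reflections of a non-degenerate hermitian space.
* §2 **`exists_mem_U_det_eq_neg_one`**: `S.U` contains an involution of determinant `−1`.
* §3 **`exists_level_carrier_character`** (any `w ∣ v`, any `N ≥ 2`): a character `Λ(g) = θ_w(det(g)_w)` of `S.U` and a Step-3 character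
  `χ_Λ(z) = θ_w(z_w)^N ∈ ChiSet S` with `Λ ∘ S.scalar = χ_Λ`, `Λ = 1` on the open neighbourhood `{g : v_w(det(g)_w − 1) < v_w(2)}` of `1`,
  an element `g₀ ∈ S.U` with `Λ(g₀) = −1` (the reflection), and, for `N` odd, `Λ(−1 · 1_N) = χ_Λ(−1) = −1`.
* §4 **`exists_lemD1IndexedFamily_item1_and_lemD1_3_twist`** (EVERY `N ≥ 3`, EVERY place, every `μ ∈ MuSet S`, every representative `e`):
  the two-member collection with labels `(μ, e, 1)`, `(μ', e, χ_Λ)` — `μ'` the level twist, `μ'(ε) = −μ(ε)` — and carriers the trivial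
  line and the line of `Λ` satisfies [Lem. D.1, first sentence + (1)] AS PRINTED member by member AND [Lem. D.1 (3)] AS PRINTED for all
  four pairs (the `ω`'s are NON-isomorphic — `Λ(g₀) = −1 ≠ 1` — and the μ-labels differ); **`exists_lemD1IndexedFamily_item1_and_lemD1_3_chi`**
  (`N` odd `≥ 3`, every place): labels `(μ, e, 1)`, `(μ, e, χ_Λ)`, the `χ`-slot ALONE separating; **`not_forall_mu_eq_twist`**: at every
  place carrying a Step-2 datum and every `N ≥ 3` the two displayed records do not force «all members carry the same `μ`».
* §5 the CM rows (`L` CM, `F = L⁺`, rows' own `μ_v = localMu L (toHeckeCharacter L ψ) v`): **`exists_lemD1IndexedFamily_item1_and_lemD1_3_localMu_twist`**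
  and **`not_forall_mu_eq_of_isCMField`** ∕ `forall_not_forall_mu_eq_of_isCMField` at EVERY place `v` of `L⁺` for EVERY `N ≥ 3` — in
  particular for the END's rank `N = 3` with no exceptional place.

What this does NOT give: a two-member model in which (3) holds and ONLY the μ-slot separates (two non-isomorphic carriers with the SAME
central character: `Λ` restricted to the centre is `χ_Λ`, which differs from `1` in general); the `χ`-alone certificate for `N` even
(`χ_Λ(−1) = θ_w(−1)^N = 1`); anything about the rows' OWN carriers `𝓢.omegaLoc v`; Lem. D.1 itself.  HC_CM is NOT proved.

Cell pub-hodgecm2 (COR-CM), audit class of the END rows `hD1''` ∕ `hD3`; seat prover-pub-hodgecm2-b10.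

References: [Liu2021] Y. Liu, *Fourier–Jacobi cycles and arithmetic relative trace formula*, Camb. J. Math. 9 (2021) =
arXiv:2102.11518, App. D §D.1 (the hermitian space `V`, l. 5213; Steps 1–3, l. 5217–5221), Lemma D.1 (1) (l. 5229), (3) (l. 5233),
Def. 4.11 (l. 2086); [Mok2014] C. P. Mok, Mem. AMS 235 (2015), §1 Notation p. 5 (`U(J)(F_v) ≤ GL_N(E ⊗ F_v)`); [NeukirchANT1999]
Ch. II §3 (higher unit groups) with Prop. (3.10); [CasselsFrohlichANT1967] Ch. II §10 (`L ⊗_K K_v = Π_{w∣v} L_w`).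
-/

noncomputable section

open scoped Matrix MatrixGroups
open NumberField IsDedekindDomain
open Literature.RepresentationTheory
open Literature.RepresentationTheory.Liu2021 (OscillatorStandingData)
open Literature.RepresentationTheory.CentralCharacterQuotient (augmentation quotRep quotRep_mk)
open Literature.NumberTheory.GaloisRepresentations (HeckeCharacter)

namespace Literature.NumberTheory.Automorphic.Liu2021.LemD1IndexedNonVacuityLevelCarrier

open UnitaryGroup

/-! ## §1 Reflections of a non-degenerate hermitian space along an anisotropic vector (algebra over the field `E`) -/

section Algebra

variable {F E : Type} [Field F] [Field E] [Algebra F E] (c : E ≃ₐ[F] E) {N : ℕ} (J : Matrix (Fin N) (Fin N) E)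

/-- hermitian symmetry entrywise: `c (J i j) = J j i`. [folklore] -/
private theorem apply_entry_of_hermitian (hJh : (J.map c)ᵀ = J) (i j : Fin N) : c (J i j) = J j i := by
  have h := congrArg (fun M : Matrix (Fin N) (Fin N) E => M j i) hJh
  simpa only [Matrix.transpose_apply, Matrix.map_apply] using h

/-- **an anisotropic vector**: a non-degenerate hermitian form on `Eᴺ`, `N ≥ 1`, takes a non-zero value `⟨x, x⟩ = Σ c(x_i) J_ij x_j`
(a diagonal entry `J_ii ≠ 0`, or, if the diagonal vanishes, `x = e_i + J_ij⁻¹ e_j` with `⟨x, x⟩ = J_ij J_ij⁻¹ + c(J_ij⁻¹ J_ij) = 2`). [folklore] -/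
private theorem exists_form_self_ne_zero [CharZero E] (hN : 1 ≤ N) (hJh : (J.map c)ᵀ = J) (hJdet : J.det ≠ 0) :
    ∃ x : Fin N → E, ((fun i => c (x i)) ᵥ* J) ⬝ᵥ x ≠ 0 := by
  classical
  have hherm := apply_entry_of_hermitian c J hJh
  by_cases hdiag : ∃ i, J i i ≠ 0
  · obtain ⟨i, hi⟩ := hdiag
    refine ⟨Pi.single i 1, ?_⟩
    have hc1 : (fun k => c ((Pi.single i (1 : E) : Fin N → E) k)) = Pi.single i 1 := by
      funext k
      by_cases hk : k = i
      · subst hk; simp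
      · simp [Pi.single_eq_of_ne hk]
    rw [hc1, Matrix.single_one_vecMul, dotProduct_single, mul_one]
    exact hi
  · push Not at hdiag
    have hJ0 : ∃ i j, J i j ≠ 0 := by
      by_contra h
      push Not at h
      apply hJdet
      have hJ : J = 0 := Matrix.ext fun i j => h i j
      haveI : Nonempty (Fin N) := ⟨⟨0, by omega⟩⟩
      rw [hJ, Matrix.det_zero]
    obtain ⟨i, j, hij⟩ := hJ0
    have hne : j ≠ i := by
      rintro rfl
      exact hij (hdiag j)
    set s : E := (J i j)⁻¹ with hs
    refine ⟨Pi.single i 1 + Pi.single j s, ?_⟩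
    have hc : (fun k => c ((Pi.single i (1 : E) + Pi.single j s : Fin N → E) k)) = Pi.single i 1 + Pi.single j (c s) := by
      funext k
      simp only [Pi.add_apply, map_add]
      by_cases hki : k = i
      · subst hki
        simp [Pi.single_eq_of_ne hne.symm]
      · by_cases hkj : k = j
        · subst hkj
          simp [Pi.single_eq_of_ne hki]
        · simp [Pi.single_eq_of_ne hki, Pi.single_eq_of_ne hkj]
    rw [hc, Matrix.add_vecMul, add_dotProduct, dotProduct_add, dotProduct_add, Matrix.single_one_vecMul,
      Matrix.single_vecMul, dotProduct_single, dotProduct_single, smul_dotProduct, smul_dotProduct,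
      dotProduct_single, dotProduct_single]
    simp only [Matrix.row_apply, smul_eq_mul, mul_one]
    rw [hdiag i, hdiag j, ← hherm i j, ← map_mul, hs, inv_mul_cancel₀ hij, mul_inv_cancel₀ hij, map_one]
    norm_num

/-- **the reflection along an anisotropic vector**: for an involution `c` and `J` hermitian non-degenerate (`N ≥ 1`) there is a matrix `R`
— namely `R = 1 − (2/q) · x · x†` with `x† = c(x)ᵀ J`, `q = ⟨x, x⟩ ≠ 0` — which is an isometry of `(Eᴺ, J)` (`(Rᶜ)ᵀ J R = J`), an involution
(`R² = 1`), and has determinant `−1` (matrix determinant lemma: `det(1 − u wᵀ) = 1 − wᵀ u = 1 − 2`). [folklore] -/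
private theorem exists_reflection [CharZero E] (hcc : ∀ x, c (c x) = x) (hN : 1 ≤ N) (hJh : (J.map c)ᵀ = J)
    (hJdet : J.det ≠ 0) :
    ∃ R : Matrix (Fin N) (Fin N) E, (R.map c)ᵀ * J * R = J ∧ R * R = 1 ∧ R.det = -1 := by
  classical
  obtain ⟨x, hq⟩ := exists_form_self_ne_zero c J hN hJh hJdet
  have hherm := apply_entry_of_hermitian c J hJh
  set xc : Fin N → E := fun i => c (x i) with hxc
  set w : Fin N → E := xc ᵥ* J with hw
  set q : E := w ⬝ᵥ x with hqdef
  set t : E := 2 / q with ht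
  -- `c ∘ w = J x`, `c q = q`, `c t = t`, `t q = 2`
  have hcw : (fun j => c (w j)) = J *ᵥ x := by
    funext j
    rw [hw, Matrix.vecMul, Matrix.mulVec, dotProduct, dotProduct, map_sum]
    refine Finset.sum_congr rfl fun i _ => ?_
    rw [map_mul, hxc, hcc, hherm, mul_comm]
  have hcq : c q = q := by
    calc c q = ∑ i, c (w i) * c (x i) := by rw [hqdef, dotProduct, map_sum]; simp_rw [map_mul]
      _ = (J *ᵥ x) ⬝ᵥ xc := by rw [← hcw]; rfl
      _ = q := by rw [dotProduct_comm, Matrix.dotProduct_mulVec, ← hw, hqdef]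
  have hct : c t = t := by rw [ht, map_div₀, map_ofNat, hcq]
  have htq : t * q = 2 := by rw [ht, div_mul_cancel₀ _ hq]
  refine ⟨1 - Matrix.vecMulVec (t • x) w, ?_, ?_, ?_⟩
  · -- isometry: `(Rᶜ)ᵀ = 1 − t · (J x) · c(x)ᵀ`, then expand with the rank-one calculus
    have hmapc : (1 - Matrix.vecMulVec (t • x) w).map c = 1 - Matrix.vecMulVec (t • xc) (J *ᵥ x) := by
      ext i j
      simp only [Matrix.map_apply, Matrix.sub_apply, Matrix.one_apply, Matrix.vecMulVec_apply, Pi.smul_apply,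
        smul_eq_mul, map_sub, map_mul, hct, ← hcw, hxc]
      split_ifs <;> simp
    rw [hmapc, Matrix.transpose_sub, Matrix.transpose_one, Matrix.transpose_vecMulVec]
    rw [Matrix.sub_mul, Matrix.one_mul, Matrix.mul_sub, Matrix.mul_one, Matrix.sub_mul,
      Matrix.vecMulVec_mul, Matrix.smul_vecMul, ← hw, Matrix.mul_vecMulVec, Matrix.mulVec_smul,
      Matrix.vecMulVec_mul_vecMulVec]
    have hinner : (t • w) ⬝ᵥ (t • x) = t * 2 := by
      rw [smul_dotProduct, dotProduct_smul, smul_eq_mul, smul_eq_mul, ← hqdef, htq]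
    rw [hinner]
    ext i j
    simp only [Matrix.sub_apply, Matrix.vecMulVec_apply, Pi.smul_apply, smul_eq_mul]
    ring
  · -- involution
    rw [Matrix.sub_mul, Matrix.one_mul, Matrix.mul_sub, Matrix.mul_one, Matrix.vecMulVec_mul_vecMulVec]
    have hinner : w ⬝ᵥ (t • x) = 2 := by
      rw [dotProduct_smul, smul_eq_mul, ← hqdef, htq]
    rw [hinner]
    ext i j
    simp only [Matrix.sub_apply, Matrix.one_apply, Matrix.vecMulVec_apply, Pi.smul_apply, smul_eq_mul]
    ring
  · -- determinant
    have hre : (1 : Matrix (Fin N) (Fin N) E) - Matrix.vecMulVec (t • x) w = 1 + Matrix.vecMulVec ((-t) • x) w := by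
      rw [Matrix.smul_vecMulVec, Matrix.smul_vecMulVec, neg_smul, sub_eq_add_neg]
    rw [hre, Matrix.vecMulVec_eq (Fin 1), Matrix.det_one_add_replicateCol_mul_replicateRow, dotProduct_smul, smul_eq_mul,
      ← hqdef, neg_mul, htq]
    norm_num

end Algebra

/-! ## §2 `U(V)(F_v)` of the place model contains a reflection: an involution of determinant `−1` -/

section PlaceModel

variable {F : Type} (E : Type) [Field F] [NumberField F] [Field E] [NumberField E] [Algebra F E]
  [Algebra.IsQuadraticExtension F E] (v : HeightOneSpectrum (𝓞 F)) (c : E ≃ₐ[F] E)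
  {δ : E} (hcδ : c δ = -δ) (hδ : δ ≠ 0)
  (N : ℕ) (J : Matrix (Fin N) (Fin N) E) (hN : 2 ≤ N) (hJh : (J.map c)ᵀ = J) (hJdet : J.det ≠ 0)

include v hcδ hδ in
/-- `c` is an involution of `E` (from `(c ⊗ 1)² = 1` on `E_v`, tree `conjLocal_conjLocal_apply`, and the injectivity of `E → E_v`).
[cite: CasselsFrohlichANT1967, Ch. II §10] -/
private theorem conj_conj_apply (x : E) : c (c x) = x :=
  (algebraMap E (LocalRing E v)).injective (by
    rw [← conjLocal_algebraMap, ← conjLocal_algebraMap, LemD1OfPlace.conjLocal_conjLocal_apply E v c hcδ hδ])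

/-- **`U(V)(F_v)` contains a REFLECTION**: an element `g` of the standing data's unitary group `S.U ≤ GL_N(E_v)` («the unitary group of
the hermitian space `V`», [Liu2021, App. D §D.1]) with `det g = −1` and `g² = 1` — the image under `E → E_v` of the reflection
`1 − (2/⟨x,x⟩) x x†` of the GLOBAL hermitian space `(Eᴺ, J)` along an anisotropic vector (§1).  EVERY `N ≥ 2`, EVERY finite place `v`.
[cite: Liu2021, App. D §D.1 (l. 5213)] [cite: Mok2014, §1 Notation p. 5] -/
theorem exists_mem_U_det_eq_neg_one :
    ∃ g : (LemD1OfPlace.standingData E v c N J hcδ hδ hN hJh hJdet).U,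
      Matrix.GeneralLinearGroup.det ((g : GL (Fin N) (LocalRing E v))) = -1 ∧ g * g = 1 := by
  set φ := algebraMap E (LocalRing E v) with hφ
  obtain ⟨R, hRJ, hRR, hRdet⟩ := exists_reflection c J (conj_conj_apply E v c hcδ hδ) (by omega) hJh hJdet
  have hRvRv : R.map φ * R.map φ = 1 := by
    rw [← Matrix.map_mul, hRR, Matrix.map_one φ (map_zero φ) (map_one φ)]
  let Rv : GL (Fin N) (LocalRing E v) := ⟨R.map φ, R.map φ, hRvRv, hRvRv⟩
  have hmem : Rv ∈ (LemD1OfPlace.standingData E v c N J hcδ hδ hN hJh hJdet).U := by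
    rw [OscillatorStandingData.mem_U_iff, LemD1OfPlace.standingData_gram, LemD1OfPlace.localGram_eq]
    have hconj : ⇑(LemD1OfPlace.standingData E v c N J hcδ hδ hN hJh hJdet).conj = conjLocal E c v :=
      funext fun x => LemD1OfPlace.standingData_conj_apply E v c N J hcδ hδ hN hJh hJdet x
    change ((R.map φ).map (LemD1OfPlace.standingData E v c N J hcδ hδ hN hJh hJdet).conj)ᵀ * J.map φ * R.map φ = J.map φ
    rw [hconj, Matrix.map_map]
    have hcφ : (conjLocal E c v) ∘ φ = φ ∘ c := funext fun x => conjLocal_algebraMap c v x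
    rw [hcφ, ← Matrix.map_map, ← Matrix.transpose_map, ← Matrix.map_mul, ← Matrix.map_mul, hRJ]
  refine ⟨⟨Rv, hmem⟩, ?_, Subtype.ext (Units.ext hRvRv)⟩
  apply Units.ext
  rw [Matrix.GeneralLinearGroup.val_det_apply, Units.val_neg, Units.val_one]
  change (R.map φ).det = -1
  rw [← RingHom.mapMatrix_apply, ← RingHom.map_det, hRdet, map_neg, map_one]

/-! ## §3 The LEVEL CARRIER CHARACTER `Λ = θ_w ∘ det_w` of `U(V)(F_v)` — any place `w ∣ v`, any `N ≥ 2` -/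

/-- For a datum whose carrier is the line `ℂ` with `U(V)(F)` acting through a character `λ` that agrees with `χ` on the centre,
the `χ`-augmentation submodule vanishes (copy of the siblings' private lemma). [folklore] -/
private theorem augmentation_eq_bot_of_character {F₀ E₀ : Type} [Field F₀] [ValuativeRel F₀] [TopologicalSpace F₀]
    [CommRing E₀] [Algebra F₀ E₀] [TopologicalSpace E₀] {n : ℕ} (L : LemD1Data F₀ E₀ n ℂ) (lam : L.S.U →* ℂˣ)
    (hω : ∀ (g : L.S.U) (x : ℂ), L.omega g x = (lam g : ℂ) * x)
    (hcen : ∀ z : L.S.normOne, lam (L.S.scalar z) = L.chi z) :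
    augmentation L.omega L.S.scalar L.chi = ⊥ := by
  unfold augmentation
  refine iSup_eq_bot.2 fun z => ?_
  rw [LinearMap.range_eq_bot]
  ext
  simp [hω, hcen]

/-- Two lines on which a group acts through characters `λ₁` and `λ₀` with `λ₁ g₀ ≠ λ₀ g₀` for some `g₀` have NON-isomorphic maximal
`χ`-quotients (the first quotient being the line itself).  Copy of the siblings' private lemma. [folklore] -/
private theorem not_areIsomorphicRep_quotRep_of_characters {G Z : Type*} [Group G] [Group Z]
    (ρ₁ ρ₀ : Representation ℂ G ℂ) {ζ : Z →* G} (hζ : ∀ z, ζ z ∈ Subgroup.center G) (χ₁ χ₀ : Z →* ℂˣ)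
    (lam₁ lam₀ : G →* ℂˣ) (h₁ : ∀ (g : G) (x : ℂ), ρ₁ g x = (lam₁ g : ℂ) * x) (h₀ : ∀ (g : G) (x : ℂ), ρ₀ g x = (lam₀ g : ℂ) * x)
    (hN₁ : augmentation ρ₁ ζ χ₁ = ⊥) {g₀ : G} (hg₀ : lam₁ g₀ ≠ lam₀ g₀) :
    ¬ AreIsomorphicRep (quotRep ρ₁ hζ χ₁) (quotRep ρ₀ hζ χ₀) := by
  rintro ⟨f, hf⟩
  have hw0 : (Submodule.Quotient.mk 1 : ℂ ⧸ augmentation ρ₁ ζ χ₁) ≠ 0 := by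
    rw [Ne, Submodule.Quotient.mk_eq_zero, hN₁, Submodule.mem_bot]
    exact one_ne_zero
  have h1 : quotRep ρ₁ hζ χ₁ g₀ (Submodule.Quotient.mk 1) =
      (lam₁ g₀ : ℂ) • (Submodule.Quotient.mk 1 : ℂ ⧸ augmentation ρ₁ ζ χ₁) := by
    rw [quotRep_mk, h₁, ← smul_eq_mul, Submodule.Quotient.mk_smul]
  have h2 : ∀ y : ℂ ⧸ augmentation ρ₀ ζ χ₀, quotRep ρ₀ hζ χ₀ g₀ y = (lam₀ g₀ : ℂ) • y := by
    intro y
    obtain ⟨u, rfl⟩ := Submodule.Quotient.mk_surjective _ y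
    rw [quotRep_mk, h₀, ← smul_eq_mul, Submodule.Quotient.mk_smul]
  have key := hf g₀ (Submodule.Quotient.mk 1)
  rw [h1, h2, map_smul] at key
  have hsub : ((lam₁ g₀ : ℂ) - lam₀ g₀) • f (Submodule.Quotient.mk 1) = 0 := by
    rw [sub_smul, key, sub_self]
  rcases smul_eq_zero.1 hsub with h | h
  · exact hg₀ (Units.ext (sub_eq_zero.1 h))
  · exact hw0 (f.injective (by rw [h, map_zero]))

/-- **Item (1) AS PRINTED holds at a character datum of rank `n ≠ 2`** (copy of the siblings' private lemma).
[cite: Liu2021, App. D Lemma D.1 (1) (l. 5229)] -/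
private theorem lemD1_1AsPrinted_of_character_of_rank_ne_two' {F₀ E₀ : Type} [Field F₀] [ValuativeRel F₀]
    [TopologicalSpace F₀] [CommRing E₀] [Algebra F₀ E₀] [TopologicalSpace E₀] [IsTopologicalRing E₀] {n₀ : ℕ}
    (L : LemD1Data F₀ E₀ n₀ ℂ) (lam : L.S.U →* ℂˣ) (hω : ∀ (g : L.S.U) (x : ℂ), L.omega g x = (lam g : ℂ) * x)
    (hcen : ∀ z : L.S.normOne, lam (L.S.scalar z) = L.chi z)
    (hopen : ∃ O : Set L.S.U, IsOpen O ∧ (1 : L.S.U) ∈ O ∧ ∀ g ∈ O, lam g = 1) (hn : n₀ ≠ 2) :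
    LemD1_1AsPrinted L := by
  have hN : augmentation L.omega L.S.scalar L.chi = ⊥ := augmentation_eq_bot_of_character L lam hω hcen
  have hfin : Module.finrank ℂ (ℂ ⧸ augmentation L.omega L.S.scalar L.chi) = 1 := by
    rw [(Submodule.quotEquivOfEqBot _ hN).finrank_eq, Module.finrank_self]
  haveI hsimple : IsSimpleModule ℂ (ℂ ⧸ augmentation L.omega L.S.scalar L.chi) :=
    isSimpleModule_iff_finrank_eq_one.2 hfin
  have hact : ∀ (g : L.S.U) (w : ℂ ⧸ augmentation L.omega L.S.scalar L.chi),
      L.datum.quot g w = (lam g : ℂ) • w := by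
    intro g w
    obtain ⟨y, rfl⟩ := Submodule.Quotient.mk_surjective _ w
    rw [LemD1Data.datum_quot, quotRep_mk, hω, ← smul_eq_mul, Submodule.Quotient.mk_smul]
  refine ⟨⟨?_, ?_, ?_⟩, ?_⟩
  · intro W
    rcases eq_bot_or_eq_top W.toSubmodule with h | h
    · exact Or.inl (Subrepresentation.toSubmodule_injective h)
    · exact Or.inr (Subrepresentation.toSubmodule_injective h)
  · intro x
    obtain ⟨O, hO, h1O, hlam⟩ := hopen
    change IsOpen (L.datum.quot.stabilizerSubgroup x : Set L.S.U)
    refine Subgroup.isOpen_of_mem_nhds _ (g := 1) (Filter.mem_of_superset (hO.mem_nhds h1O) fun g hg => ?_)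
    change L.datum.quot g x = x
    rw [hact, hlam g hg, Units.val_one, one_smul]
  · intro K _
    infer_instance
  · refine iff_of_false ?_ ?_
    · rw [not_subsingleton_iff_nontrivial]
      exact Module.nontrivial_of_finrank_pos (R := ℂ) (by rw [hfin]; exact one_pos)
    · exact fun h => hn h.2.1.2

/-- A homomorphism with open kernel is locally constant (copy of the tree's private lemma). [folklore] -/
private theorem isLocallyConstant_of_isOpen_ker {Γ G : Type*} [Group Γ] [TopologicalSpace Γ]
    [ContinuousMul Γ] [Group G] (r : Γ →* G) (h : IsOpen (r.ker : Set Γ)) :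
    IsLocallyConstant r := by
  refine (IsLocallyConstant.iff_exists_open r).2 fun σ => ⟨{τ | σ⁻¹ * τ ∈ r.ker}, ?_, ?_, ?_⟩
  · exact h.preimage (continuous_const_mul σ⁻¹)
  · show σ⁻¹ * σ ∈ r.ker
    rw [inv_mul_cancel]; exact r.ker.one_mem
  · intro τ hτ
    have hτ' : r (σ⁻¹ * τ) = 1 := hτ
    rw [map_mul, map_inv, inv_mul_eq_one] at hτ'
    exact hτ'.symm

omit [Algebra.IsQuadraticExtension F E] in
/-- `v_w(2) ≠ 0` in `E_w` (characteristic `0`). [folklore] -/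
private theorem valued_two_ne_zero (w : HeightOneSpectrum (𝓞 E)) : Valued.v (2 : w.adicCompletion E) ≠ 0 := by
  refine (Valuation.ne_zero_iff _).2 ?_
  have : (2 : w.adicCompletion E) = algebraMap E (w.adicCompletion E) 2 := by rw [map_ofNat]
  rw [this]
  exact (map_ne_zero_iff _ (algebraMap E (w.adicCompletion E)).injective).2 two_ne_zero

omit [Algebra.IsQuadraticExtension F E] in
/-- the level set `{y : v_w(y − 1) < v_w(2)} = 1 + 2𝔭_w` is open in `E_w` (copy of the private lemma of `…LevelTwist`).
[cite: NeukirchANT1999, Ch. II §3 Prop. (3.10)] -/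
private theorem isOpen_setOf_valued_sub_one_lt_two (w : HeightOneSpectrum (𝓞 E)) :
    IsOpen {y : w.adicCompletion E | Valued.v (y - 1) < Valued.v (2 : w.adicCompletion E)} := by
  have h := (Valued.isOpen_ball (w.adicCompletion E) (Valued.v.restrict (2 : w.adicCompletion E))).preimage
    (show Continuous fun y : w.adicCompletion E => y - 1 from continuous_id.sub continuous_const)
  convert h using 1
  ext y
  simp only [Set.mem_setOf_eq, Set.mem_preimage, Valuation.restrict_lt_iff]

/-- `−1 ∈ E_v¹ = S.normOne`. [cite: Liu2021, App. D §D.1 Step 3 (l. 5221)] -/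
private theorem neg_one_mem_normOne :
    (-1 : (LocalRing E v)ˣ) ∈ (LemD1OfPlace.standingData E v c N J hcδ hδ hN hJh hJdet).normOne := by
  rw [OscillatorStandingData.mem_normOne_iff']
  change ((-1 : (LocalRing E v)ˣ) : LocalRing E v) * conjLocal E c v ((-1 : (LocalRing E v)ˣ) : LocalRing E v) = 1
  rw [Units.val_neg, Units.val_one, map_neg, map_one, neg_mul_neg, one_mul]

include hcδ in
/-- **the LEVEL carrier character**: at ANY place `w ∣ v` and for ANY `N ≥ 2` there are a character `Λ` of `U(V)(F_v) = S.U`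
(`Λ(g) = θ_w(det(g)_w)`, `θ_w` the level character of `LemD1IndexedNonVacuityLevelTwist.exists_level_character`) and a Step-3 character
`χ_Λ ∈ ChiSet S` (`χ_Λ(z) = θ_w(z_w)^N`) such that `Λ ∘ S.scalar = χ_Λ` (`det(z · 1_N) = z^N`), `Λ` is trivial on the open neighbourhood
`{g : v_w(det(g)_w − 1) < v_w(2)}` of `1`, some `g₀ ∈ S.U` — the REFLECTION of §2, `det g₀ = −1` — has `Λ(g₀) = θ_w(−1) = −1`, and, when `N`
is odd, `Λ(−1 · 1_N) = χ_Λ(−1) = −1` as well.  Non-parity, every-place form of `LemD1IndexedNonVacuityTameCarrier.exists_tame_carrier_character`.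
[cite: Liu2021, App. D §D.1 Step 3 (l. 5221)] [cite: Mok2014, §1 Notation p. 5] [cite: NeukirchANT1999, Ch. II §3 Prop. (3.10)] -/
theorem exists_level_carrier_character (w : PlacesOver E v) :
    ∃ (Λ : (LemD1OfPlace.standingData E v c N J hcδ hδ hN hJh hJdet).U →* ℂˣ)
      (χ : LemD1.ChiSet (LemD1OfPlace.standingData E v c N J hcδ hδ hN hJh hJdet)),
      (∀ z : (LemD1OfPlace.standingData E v c N J hcδ hδ hN hJh hJdet).normOne,
        Λ ((LemD1OfPlace.standingData E v c N J hcδ hδ hN hJh hJdet).scalar z) = χ.1 z) ∧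
      (∃ O : Set (LemD1OfPlace.standingData E v c N J hcδ hδ hN hJh hJdet).U, IsOpen O ∧ 1 ∈ O ∧ ∀ g ∈ O, Λ g = 1) ∧
      (∃ g₀ : (LemD1OfPlace.standingData E v c N J hcδ hδ hN hJh hJdet).U, Λ g₀ = -1) ∧
      (Odd N →
        Λ ((LemD1OfPlace.standingData E v c N J hcδ hδ hN hJh hJdet).scalar
          ⟨-1, neg_one_mem_normOne E v c hcδ hδ N J hN hJh hJdet⟩) = -1 ∧
        χ.1 ⟨-1, neg_one_mem_normOne E v c hcδ hδ N J hN hJh hJdet⟩ = -1) := by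
  set S := LemD1OfPlace.standingData E v c N J hcδ hδ hN hJh hJdet with hS
  obtain ⟨θ, hθopen, -, hθnorm, hθlevel, hθneg⟩ := LemD1IndexedNonVacuityLevelTwist.exists_level_character w.1
  have hθsq : θ (-1) = -1 := by
    have h1 : θ (-1) ^ 2 = 1 := by rw [← map_pow, neg_one_sq, map_one]
    have h2' : (((θ (-1) : ℂˣ) : ℂ)) ^ 2 = 1 := by rw [← Units.val_pow_eq_pow_val, h1, Units.val_one]
    rcases sq_eq_one_iff.1 h2' with h | h
    · exact absurd (Units.ext h) hθneg
    · exact Units.ext (by rw [h, Units.val_neg, Units.val_one])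
  let prw : (LocalRing E v)ˣ →* (w.1.adicCompletion E)ˣ :=
    Units.map (Pi.evalRingHom (fun w' : PlacesOver E v => w'.1.adicCompletion E) w).toMonoidHom
  have hprw : ∀ y : (LocalRing E v)ˣ, ((prw y : (w.1.adicCompletion E)ˣ) : w.1.adicCompletion E) = (y : LocalRing E v) w :=
    fun y => rfl
  have hθc : Continuous fun x : (LocalRing E v)ˣ => ((θ (prw x) : ℂˣ) : ℂ) :=
    (Units.continuous_val.comp (isLocallyConstant_of_isOpen_ker θ hθopen).continuous).comp
      (Continuous.units_map _ (continuous_apply w))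
  let detU : S.U →* (LocalRing E v)ˣ := Matrix.GeneralLinearGroup.det.comp S.U.subtype
  let Λ : S.U →* ℂˣ := θ.comp (prw.comp detU)
  have hΛ : ∀ g : S.U, Λ g = θ (prw (Matrix.GeneralLinearGroup.det (g : GL (Fin N) (LocalRing E v)))) := fun g => rfl
  let χ₀ : S.normOne →* ℂˣ := (θ.comp (prw.comp S.normOne.subtype)) ^ N
  have hχ₀ : ∀ z : S.normOne, χ₀ z = θ (prw (z : (LocalRing E v)ˣ)) ^ N := fun z => rfl
  let χ : LemD1.ChiSet S := ⟨χ₀, fun z => by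
      rw [hχ₀, Units.val_pow_eq_pow_val, norm_pow, hθnorm, one_pow],
    by
      have : (fun z : S.normOne => ((χ₀ z : ℂˣ) : ℂ)) =
          fun z : S.normOne => (((θ (prw (z : (LocalRing E v)ˣ)) : ℂˣ) : ℂ)) ^ N := by
        funext z; rw [hχ₀, Units.val_pow_eq_pow_val]
      rw [this]
      exact (hθc.comp continuous_subtype_val).pow N⟩
  -- det of a scalar
  have hdet : ∀ z : S.normOne, Matrix.GeneralLinearGroup.det ((S.scalar z : S.U) : GL (Fin N) (LocalRing E v)) =
      (z : (LocalRing E v)ˣ) ^ N := fun z => by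
    apply Units.ext
    rw [Matrix.GeneralLinearGroup.val_det_apply, OscillatorStandingData.coe_scalar, Matrix.scalar_apply, Matrix.det_diagonal,
      Finset.prod_const, Finset.card_univ, Fintype.card_fin, Units.val_pow_eq_pow_val]
  have hcen : ∀ z : S.normOne, Λ (S.scalar z) = χ.1 z := fun z => by
    change Λ (S.scalar z) = χ₀ z
    rw [hΛ, hdet, map_pow, map_pow, hχ₀]
  -- the reflection
  obtain ⟨g₀, hg₀det, -⟩ := exists_mem_U_det_eq_neg_one E v c hcδ hδ N J hN hJh hJdet
  have hΛg₀ : Λ g₀ = -1 := by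
    rw [hΛ, hg₀det]
    have : prw (-1) = -1 := Units.ext rfl
    rw [this, hθsq]
  refine ⟨Λ, χ, hcen, ?_, ⟨g₀, hΛg₀⟩, fun hNo => ?_⟩
  · -- the open neighbourhood of `1` on which `Λ = 1`
    let f : S.U → w.1.adicCompletion E := fun g =>
      (((g : GL (Fin N) (LocalRing E v)) : Matrix (Fin N) (Fin N) (LocalRing E v)).map
        (Pi.evalRingHom (fun w' : PlacesOver E v => w'.1.adicCompletion E) w)).det
    have hf : ∀ g : S.U, f g = ((prw (Matrix.GeneralLinearGroup.det (g : GL (Fin N) (LocalRing E v))) :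
        (w.1.adicCompletion E)ˣ) : w.1.adicCompletion E) := fun g => by
      rw [hprw, Matrix.GeneralLinearGroup.val_det_apply]
      change _ = (Pi.evalRingHom (fun w' : PlacesOver E v => w'.1.adicCompletion E) w)
        (((g : GL (Fin N) (LocalRing E v)) : Matrix (Fin N) (Fin N) (LocalRing E v)).det)
      rw [RingHom.map_det]
      rfl
    have hfc : Continuous f := by
      refine Continuous.matrix_det ?_
      refine Continuous.matrix_map ?_ (continuous_apply w)
      exact Units.continuous_val.comp continuous_subtype_val
    refine ⟨f ⁻¹' {y | Valued.v (y - 1) < Valued.v (2 : w.1.adicCompletion E)},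
      (isOpen_setOf_valued_sub_one_lt_two E w.1).preimage hfc, ?_, fun g hg => ?_⟩
    · rw [Set.mem_preimage, Set.mem_setOf_eq, hf, OneMemClass.coe_one, map_one, map_one, Units.val_one, sub_self, map_zero]
      exact zero_lt_iff.2 (valued_two_ne_zero E w.1)
    · rw [Set.mem_preimage, Set.mem_setOf_eq, hf] at hg
      rw [hΛ]
      exact hθlevel _ hg
  · -- `N` odd: the central element `−1 · 1_N`
    have hm1 : χ.1 ⟨-1, neg_one_mem_normOne E v c hcδ hδ N J hN hJh hJdet⟩ = -1 := by
      change χ₀ _ = -1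
      rw [hχ₀]
      change θ (prw (-1)) ^ N = -1
      have : prw (-1) = -1 := Units.ext rfl
      rw [this, hθsq, hNo.neg_one_pow]
    exact ⟨by rw [hcen, hm1], hm1⟩

/-! ## §4 The JOINT certificates «(1) for every member ∧ (3)» — EVERY `N ≥ 3`, EVERY place -/

include hcδ in
/-- **(1) ∧ (3) JOINTLY with TWO μ-labels, for EVERY rank `N ≥ 3` at EVERY place** (split, inert or ramified; above `2` or not): for every
element `μ` of the printed Step-2 index set and every representative `e`, the two-member collection with labels `(μ, e, 1)` and
`(μ', e, χ_Λ)` — `μ'` the level twist (`μ'(ε) = −μ(ε)`) — and carriers the trivial line and the line of the level carrier character `Λ`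
(§3) satisfies [Lem. D.1, first sentence + (1)] AS PRINTED member by member AND [Lem. D.1 (3)] AS PRINTED for all four pairs (the two `ω`'s
are NON-isomorphic — `Λ(g₀) = −1 ≠ 1` at the reflection `g₀` — and the μ-labels differ), with `Lf.mu 0 ≠ Lf.mu 1`.
`LemD1IndexedNonVacuityTameCarrier.exists_lemD1IndexedFamily_item1_and_lemD1_3_twist` needed `w ∤ 2` and `N` odd.
[cite: Liu2021, App. D Lemma D.1 (1) and (3) (l. 5229, 5233)] -/
theorem exists_lemD1IndexedFamily_item1_and_lemD1_3_twist (w : PlacesOver E v) (h3 : 3 ≤ N)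
    (μ : LemD1.MuSet (LemD1OfPlace.standingData E v c N J hcδ hδ hN hJh hJdet))
    (e : LemD1.EpsRep (LemD1OfPlace.standingData E v c N J hcδ hδ hN hJh hJdet)) :
    ∃ Lf : LemD1IndexedFamily (v.adicCompletion F) (LocalRing E v) N (Fin 2),
      Lf.S = LemD1OfPlace.standingData E v c N J hcδ hδ hN hJh hJdet ∧
      (∀ i, (Lf.eps i).1 = e.1) ∧ (Lf.chi 0).1 = 1 ∧ (Lf.mu 0).1 = μ.1 ∧
      (Lf.mu 1).1 (LemD1OfPlace.eps E v hδ) = -μ.1 (LemD1OfPlace.eps E v hδ) ∧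
      Lf.Item1AsPrinted ∧ LemD1_3AsPrintedI Lf ∧ Lf.mu 0 ≠ Lf.mu 1 ∧
      ¬ AreIsomorphicRep (Lf.quot 1) (Lf.quot 0) := by
  classical
  obtain ⟨e₁, he₁⟩ := e
  have hN2 : N ≠ 2 := by omega
  obtain ⟨μ₁, hne, hμ₁, -⟩ := LemD1IndexedNonVacuityLevelTwist.exists_muSet_ne_twist E v c hcδ hδ N J hN hJh hJdet w μ
  obtain ⟨Λ, χ₁, hcen, hopen, ⟨g₀, hΛg₀⟩, -⟩ := exists_level_carrier_character E v c hcδ hδ N J hN hJh hJdet w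
  let S := LemD1OfPlace.standingData E v c N J hcδ hδ hN hJh hJdet
  let χ₀ : LemD1.ChiSet S := ⟨1, fun z => by simp, by simpa using continuous_const⟩
  let ω₀ : Representation ℂ S.U ℂ := Representation.trivial ℂ S.U ℂ
  let ω₁ : Representation ℂ S.U ℂ := (DistribMulAction.toModuleEnd ℂ ℂ).comp Λ
  have hω₀ : ∀ (g : S.U) (x : ℂ), ω₀ g x = ((1 : S.U →* ℂˣ) g : ℂ) * x := fun g x => by
    rw [MonoidHom.one_apply, Units.val_one, one_mul]; rfl
  have hω₁ : ∀ (g : S.U) (x : ℂ), ω₁ g x = (Λ g : ℂ) * x := fun g x => by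
    change (Λ g : ℂˣ) • x = _
    rw [Units.smul_def, smul_eq_mul]
  let Lf : LemD1IndexedFamily (v.adicCompletion F) (LocalRing E v) N (Fin 2) :=
    { isNonarchimedeanLocalField := inferInstance
      isModuleTopology := LemD1OfPlace.isModuleTopology_localRing E v
      S := S
      mu := ![μ, μ₁]
      eps := fun _ => ⟨e₁, he₁⟩
      chi := ![χ₀, χ₁]
      V := fun _ => ℂ
      omega := ![ω₀, ω₁] }
  have hμne : Lf.mu 0 ≠ Lf.mu 1 := fun h => hne h.symm
  -- non-isomorphism: `Λ(g₀) = −1 ≠ 1`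
  have hN₁ : augmentation (Lf.single 1).omega (Lf.single 1).S.scalar (Lf.single 1).chi = ⊥ :=
    augmentation_eq_bot_of_character (Lf.single 1) Λ hω₁ hcen
  have hg₀ : Λ g₀ ≠ (1 : S.U →* ℂˣ) g₀ := by
    rw [hΛg₀, MonoidHom.one_apply]
    intro h
    have h'' := Units.ext_iff.1 h
    rw [Units.val_one, Units.val_neg, Units.val_one] at h''
    norm_num at h''
  have hnotiso : ¬ AreIsomorphicRep (Lf.quot 1) (Lf.quot 0) :=
    not_areIsomorphicRep_quotRep_of_characters ω₁ ω₀ S.scalar_mem_center χ₁.1 (1 : S.normOne →* ℂˣ) Λ 1 hω₁ hω₀ hN₁ hg₀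
  -- (1) member by member
  have hItem1 : Lf.Item1AsPrinted := by
    intro i
    fin_cases i
    · exact lemD1_1AsPrinted_of_character_of_rank_ne_two' (Lf.single 0) 1 hω₀ (fun z => rfl)
        ⟨Set.univ, isOpen_univ, Set.mem_univ _, fun g _ => rfl⟩ hN2
    · exact lemD1_1AsPrinted_of_character_of_rank_ne_two' (Lf.single 1) Λ hω₁ hcen hopen hN2
  -- (3) for all four pairs
  have hrefl : ∀ k : Fin 2, (AreIsomorphicRep (Lf.quot k) (Lf.quot k) ↔
      (Lf.mu k = Lf.mu k ∧ LemD1.SameClass (Lf.eps k) (Lf.eps k) ∧ Lf.chi k = Lf.chi k)) :=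
    fun k => iff_of_true ⟨LinearEquiv.refl ℂ _, fun _ _ => rfl⟩ ⟨rfl, ⟨1, by simp⟩, rfl⟩
  have hItem3 : LemD1_3AsPrintedI Lf := by
    intro _ i j
    fin_cases i <;> fin_cases j
    · exact hrefl 0
    · exact iff_of_false hnotiso fun h => hμne h.1.symm
    · exact iff_of_false (fun h => hnotiso h.symm) fun h => hμne h.1
    · exact hrefl 1
  exact ⟨Lf, rfl, fun _ => rfl, rfl, rfl, hμ₁, hItem1, hItem3, hμne, hnotiso⟩

include hcδ in
/-- **(1) ∧ (3) JOINTLY, the `χ`-conjunct deciding ALONE, at EVERY place, `N` odd `≥ 3`**: for every Step-2 element `μ` and every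
representative `e`, the two-member collection with labels `(μ, e, 1)`, `(μ, e, χ_Λ)` (same `μ`, same `ε`; `χ_Λ(−1) = θ_w(−1)^N = −1 ≠ 1`)
and carriers the trivial line and the line of `Λ` satisfies (1) member by member and (3) for all four pairs — the `ω`'s are NON-isomorphic
and exactly the `χ`-slot separates the labels.  (`…TameCarrier.…_chi` needed `w ∤ 2`.) [cite: Liu2021, App. D Lemma D.1 (1) and (3) (l. 5229, 5233)] -/
theorem exists_lemD1IndexedFamily_item1_and_lemD1_3_chi (w : PlacesOver E v) (hNo : Odd N) (h3 : 3 ≤ N)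
    (μ : LemD1.MuSet (LemD1OfPlace.standingData E v c N J hcδ hδ hN hJh hJdet))
    (e : LemD1.EpsRep (LemD1OfPlace.standingData E v c N J hcδ hδ hN hJh hJdet)) :
    ∃ Lf : LemD1IndexedFamily (v.adicCompletion F) (LocalRing E v) N (Fin 2),
      Lf.S = LemD1OfPlace.standingData E v c N J hcδ hδ hN hJh hJdet ∧
      (∀ i, (Lf.eps i).1 = e.1) ∧ (∀ i, (Lf.mu i).1 = μ.1) ∧ (Lf.chi 0).1 = 1 ∧
      Lf.Item1AsPrinted ∧ LemD1_3AsPrintedI Lf ∧ Lf.mu 0 = Lf.mu 1 ∧ Lf.chi 0 ≠ Lf.chi 1 ∧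
      ¬ AreIsomorphicRep (Lf.quot 1) (Lf.quot 0) := by
  classical
  obtain ⟨e₁, he₁⟩ := e
  have hN2 : N ≠ 2 := by omega
  obtain ⟨Λ, χ₁, hcen, hopen, ⟨g₀, hΛg₀⟩, hodd⟩ := exists_level_carrier_character E v c hcδ hδ N J hN hJh hJdet w
  obtain ⟨-, hχm1⟩ := hodd hNo
  let S := LemD1OfPlace.standingData E v c N J hcδ hδ hN hJh hJdet
  let χ₀ : LemD1.ChiSet S := ⟨1, fun z => by simp, by simpa using continuous_const⟩
  let ω₀ : Representation ℂ S.U ℂ := Representation.trivial ℂ S.U ℂ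
  let ω₁ : Representation ℂ S.U ℂ := (DistribMulAction.toModuleEnd ℂ ℂ).comp Λ
  have hω₀ : ∀ (g : S.U) (x : ℂ), ω₀ g x = ((1 : S.U →* ℂˣ) g : ℂ) * x := fun g x => by
    rw [MonoidHom.one_apply, Units.val_one, one_mul]; rfl
  have hω₁ : ∀ (g : S.U) (x : ℂ), ω₁ g x = (Λ g : ℂ) * x := fun g x => by
    change (Λ g : ℂˣ) • x = _
    rw [Units.smul_def, smul_eq_mul]
  let Lf : LemD1IndexedFamily (v.adicCompletion F) (LocalRing E v) N (Fin 2) :=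
    { isNonarchimedeanLocalField := inferInstance
      isModuleTopology := LemD1OfPlace.isModuleTopology_localRing E v
      S := S
      mu := fun _ => μ
      eps := fun _ => ⟨e₁, he₁⟩
      chi := ![χ₀, χ₁]
      V := fun _ => ℂ
      omega := ![ω₀, ω₁] }
  have hχne : Lf.chi 0 ≠ Lf.chi 1 := fun h => by
    have h' := congrArg (fun χ : LemD1.ChiSet S => χ.1 ⟨-1, neg_one_mem_normOne E v c hcδ hδ N J hN hJh hJdet⟩) h
    change (1 : S.normOne →* ℂˣ) _ = χ₁.1 _ at h'
    rw [MonoidHom.one_apply, hχm1] at h'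
    have h'' := Units.ext_iff.1 h'
    rw [Units.val_one, Units.val_neg, Units.val_one] at h''
    norm_num at h''
  have hN₁ : augmentation (Lf.single 1).omega (Lf.single 1).S.scalar (Lf.single 1).chi = ⊥ :=
    augmentation_eq_bot_of_character (Lf.single 1) Λ hω₁ hcen
  have hg₀ : Λ g₀ ≠ (1 : S.U →* ℂˣ) g₀ := by
    rw [hΛg₀, MonoidHom.one_apply]
    intro h
    have h'' := Units.ext_iff.1 h
    rw [Units.val_one, Units.val_neg, Units.val_one] at h''
    norm_num at h''
  have hnotiso : ¬ AreIsomorphicRep (Lf.quot 1) (Lf.quot 0) :=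
    not_areIsomorphicRep_quotRep_of_characters ω₁ ω₀ S.scalar_mem_center χ₁.1 (1 : S.normOne →* ℂˣ) Λ 1 hω₁ hω₀ hN₁ hg₀
  have hItem1 : Lf.Item1AsPrinted := by
    intro i
    fin_cases i
    · exact lemD1_1AsPrinted_of_character_of_rank_ne_two' (Lf.single 0) 1 hω₀ (fun z => rfl)
        ⟨Set.univ, isOpen_univ, Set.mem_univ _, fun g _ => rfl⟩ hN2
    · exact lemD1_1AsPrinted_of_character_of_rank_ne_two' (Lf.single 1) Λ hω₁ hcen hopen hN2
  have hrefl : ∀ k : Fin 2, (AreIsomorphicRep (Lf.quot k) (Lf.quot k) ↔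
      (Lf.mu k = Lf.mu k ∧ LemD1.SameClass (Lf.eps k) (Lf.eps k) ∧ Lf.chi k = Lf.chi k)) :=
    fun k => iff_of_true ⟨LinearEquiv.refl ℂ _, fun _ _ => rfl⟩ ⟨rfl, ⟨1, by simp⟩, rfl⟩
  have hItem3 : LemD1_3AsPrintedI Lf := by
    intro _ i j
    fin_cases i <;> fin_cases j
    · exact hrefl 0
    · exact iff_of_false hnotiso fun h => hχne h.2.2.symm
    · exact iff_of_false (fun h => hnotiso h.symm) fun h => hχne h.2.2
    · exact hrefl 1
  exact ⟨Lf, rfl, fun _ => rfl, fun _ => rfl, rfl, hItem1, hItem3, rfl, hχne, hnotiso⟩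

include hcδ in
/-- **Consequence — EVERY place carrying a Step-2 datum, EVERY `N ≥ 3`**: the two displayed records read on an indexed collection over the
place model do NOT by their shape force «all members carry the same Step-2 character `μ`» (so a conclusion `μ_i = μ_j` drawn from them
downstream is not vacuous-by-collapse anywhere).  `…TameCarrier.not_forall_mu_eq_twist` needed `w ∤ 2` and `N` odd.
[cite: Liu2021, App. D Lemma D.1 (1) and (3) (l. 5229, 5233)] -/
theorem not_forall_mu_eq_twist (h3 : 3 ≤ N)
    (hμ : Nonempty (LemD1.MuSet (LemD1OfPlace.standingData E v c N J hcδ hδ hN hJh hJdet))) :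
    ¬ ∀ Lf : LemD1IndexedFamily (v.adicCompletion F) (LocalRing E v) N (Fin 2),
        Lf.S = LemD1OfPlace.standingData E v c N J hcδ hδ hN hJh hJdet →
        Lf.Item1AsPrinted → LemD1_3AsPrintedI Lf → ∀ i j : Fin 2, Lf.mu i = Lf.mu j := by
  obtain ⟨w⟩ := (inferInstance : Nonempty (PlacesOver E v))
  obtain ⟨μ⟩ := hμ
  intro h
  obtain ⟨Lf, hS, -, -, -, -, h1, h3', hne, -⟩ := exists_lemD1IndexedFamily_item1_and_lemD1_3_twist E v c hcδ hδ N J hN hJh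
    hJdet w h3 μ (LemD1OfPlace.epsDelta E v c N J hcδ hδ hN hJh hJdet)
  exact hne (h Lf hS h1 h3' 0 1)

end PlaceModel

/-! ## §5 The CM rows: the joint certificates with the rows' OWN μ-slot as member `0` — EVERY place `v` of `L⁺`, EVERY `N ≥ 3` -/

section CM

open Literature.NumberTheory.GelbartRogawski1991.UnitaryDualPair (imagUnit complexConj_imagUnit imagUnit_ne_zero)
open Literature.NumberTheory.GelbartRogawski1991.UnitaryDualPair.LocalSplitting (localMu norm_localMu continuous_localMu
  localMu_toLocalRing_eq_one_iff)
open Literature.NumberTheory.Automorphic.IdeleClassGroup (toHeckeCharacter isUnitary_toHeckeCharacter IsConjugateSymplectic)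
open Literature.RepresentationTheory.Liu2021 (isOscillatorChar_toHeckeCharacter_iff)

variable (L : Type) [Field L] [NumberField L] [IsCMField L]

local notation3 "cc" => (IsCMField.complexConj L)
local notation3 "L⁺" => (↥(maximalRealSubfield L))

variable (v : HeightOneSpectrum (𝓞 (maximalRealSubfield L))) (N : ℕ) (J : Matrix (Fin N) (Fin N) L) (hN : 2 ≤ N)
  (hJh : (J.map (IsCMField.complexConj L))ᵀ = J) (hJdet : J.det ≠ 0)

/-- **the joint certificate with the rows' OWN `μ_v` as member `0` — EVERY `v` of `L⁺`, EVERY `N ≥ 3`** (every conjugate symplectic `ψ`):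
labels `(μ_v, ε, 1)`, `(μ', ε, χ_Λ)` with `μ_v = localMu L (toHeckeCharacter L ψ) v` packaged by `LemD1OfPlace.muOf` with VERBATIM the
displayed proofs and `μ'(ε) = −μ_v(ε)`; carriers the trivial line and the level carrier line; (1) member by member AND (3) for all four
pairs; `Lf.mu 0 ≠ Lf.mu 1`; the `ω`'s non-isomorphic. [cite: Liu2021, App. D Lemma D.1 (1) and (3) (l. 5229, 5233); Def. 4.11 (l. 2086)] -/
theorem exists_lemD1IndexedFamily_item1_and_lemD1_3_localMu_twist (h3 : 3 ≤ N)
    (ψ : IdeleClassGroup L →ₜ* Circle) (hψ : IsConjugateSymplectic L ψ) :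
    ∃ Lf : LemD1IndexedFamily (v.adicCompletion L⁺) (LocalRing L v) N (Fin 2),
      Lf.S = LemD1OfPlace.standingData L v cc N J (complexConj_imagUnit L) (imagUnit_ne_zero L) hN hJh hJdet ∧
      (∀ i, (Lf.eps i).1 = LemD1OfPlace.eps L v (imagUnit_ne_zero L)) ∧ (Lf.chi 0).1 = 1 ∧
      (Lf.mu 0).1 = localMu L (toHeckeCharacter L ψ) v ∧
      (Lf.mu 1).1 (LemD1OfPlace.eps L v (imagUnit_ne_zero L)) =
        -localMu L (toHeckeCharacter L ψ) v (LemD1OfPlace.eps L v (imagUnit_ne_zero L)) ∧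
      Lf.Item1AsPrinted ∧ LemD1_3AsPrintedI Lf ∧ Lf.mu 0 ≠ Lf.mu 1 ∧
      ¬ AreIsomorphicRep (Lf.quot 1) (Lf.quot 0) := by
  obtain ⟨w⟩ := (inferInstance : Nonempty (PlacesOver L v))
  exact exists_lemD1IndexedFamily_item1_and_lemD1_3_twist L v cc (complexConj_imagUnit L) (imagUnit_ne_zero L) N J hN hJh hJdet w h3
    (LemD1OfPlace.muOf L v cc N J (complexConj_imagUnit L) (imagUnit_ne_zero L) hN hJh hJdet
      (localMu L (toHeckeCharacter L ψ) v)
      (fun x => norm_localMu L (toHeckeCharacter L ψ) v (isUnitary_toHeckeCharacter L ψ) x)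
      (continuous_localMu L (toHeckeCharacter L ψ) v)
      (fun t => localMu_toLocalRing_eq_one_iff L (toHeckeCharacter L ψ) v
        ((isOscillatorChar_toHeckeCharacter_iff ψ).mpr hψ) t))
    (LemD1OfPlace.epsDelta L v cc N J (complexConj_imagUnit L) (imagUnit_ne_zero L) hN hJh hJdet)

/-- **the records `hD1''` ∕ `hD3` read at the rows' slot types do not force «all members carry the same `μ`» — at ANY place `v` of `L⁺`,
for ANY `N ≥ 3`** (the END's rank is `3`; no exceptional place, no parity condition). [cite: Liu2021, App. D Lemma D.1 (1) and (3) (l. 5229, 5233)] -/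
theorem not_forall_mu_eq_of_isCMField (h3 : 3 ≤ N) :
    ¬ ∀ Lf : LemD1IndexedFamily (v.adicCompletion L⁺) (LocalRing L v) N (Fin 2),
        Lf.S = LemD1OfPlace.standingData L v cc N J (complexConj_imagUnit L) (imagUnit_ne_zero L) hN hJh hJdet →
        Lf.Item1AsPrinted → LemD1_3AsPrintedI Lf → ∀ i j : Fin 2, Lf.mu i = Lf.mu j :=
  not_forall_mu_eq_twist L v cc (complexConj_imagUnit L) (imagUnit_ne_zero L) N J hN hJh hJdet h3
    (LemD1IndexedNonVacuityNonsplitPlace.nonempty_muSet_of_isCMField L v N J hN hJh hJdet)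

/-- **the `∀ v` form**: at EVERY finite place of `L⁺` simultaneously. [cite: Liu2021, App. D Lemma D.1 (1) and (3) (l. 5229, 5233)] -/
theorem forall_not_forall_mu_eq_of_isCMField (h3 : 3 ≤ N) :
    ∀ v : HeightOneSpectrum (𝓞 L⁺),
      ¬ ∀ Lf : LemD1IndexedFamily (v.adicCompletion L⁺) (LocalRing L v) N (Fin 2),
          Lf.S = LemD1OfPlace.standingData L v cc N J (complexConj_imagUnit L) (imagUnit_ne_zero L) hN hJh hJdet →
          Lf.Item1AsPrinted → LemD1_3AsPrintedI Lf → ∀ i j : Fin 2, Lf.mu i = Lf.mu j :=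
  fun v => not_forall_mu_eq_of_isCMField L v N J hN hJh hJdet h3

end CM

end Literature.NumberTheory.Automorphic.Liu2021.LemD1IndexedNonVacuityLevelCarrier

end
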